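import Summits.KontsevichZagierPeriods.KontsevichZagierPeriods.Theses.TerasomaMultiplication
import Summits.KontsevichZagierPeriods.KontsevichZagierPeriods.Theorems.MultiplicationThree.Negative.Pinned
import Summits.KontsevichZagierPeriods.KontsevichZagierPeriods.Theorems.MultiplicationThree.Negative.BolzaLever
import Literature.NumberTheory.Transcendental.KZMellinFibres
import Literature.NumberTheory.Transcendental.KZSubcalculusInvariants
import Literature.NumberTheory.Transcendental.KZDominatedFamilyRelations
import Literature.NumberTheory.Transcendental.KZLogCalculusProofs
import Literature.NumberTheory.Transcendental.KZSemialgebraicComplex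
import Mathlib.Analysis.SpecialFunctions.Pow.Deriv

/-!
# `MultiplicationThree` (stmt-KontsevichZagierPeriods-3598), line `bolza-involution-real-quotient`:
# stub S5 — the coarea shear on the max cell of the simplex

Stub `stub_maxCellToMaxCellImage` of the crux `MultiplicationThree` (route `TerasomaMultiplication`; lead skeleton
`Cruxes/MultiplicationThree/Lines/bolza-involution-real-quotient.lean`).

Coordinates on the simplex side: `σ₁ = x 0`, `σ₂ = x 1`, `σ₃ = 3 − σ₁ − σ₂`; the max cell is
`M₃ = {σ₁, σ₂, σ₃ > 0, σ₃ > σ₁, σ₃ > σ₂}`. The coarea shear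
`Θ(σ₁, σ₂) = (c, a) = (σ₁σ₂σ₃, σ₁)` (a polynomial map, hence `ℚ`-semialgebraic) has
Jacobian determinant `det DΘ = −σ₁(3 − σ₁ − 2σ₂) = −σ₁(σ₃ − σ₂)` (`s5_det_ΘJ`), is injective on the
sheet `σ₂ < σ₃` containing `M₃` (`s5_injOn_Θ`), and maps `M₃` onto
`maxCellImage = {(c, a) | 0 < c, 0 < a < 3/2, 4c < a(3 − a)², (a ≤ 1 ∨ c < a²(3 − 2a))}`
(`s5_image_Θ`; the inverse branch is `σ₂ = ((3 − a) − √((3 − a)² − 4c/a))/2`). With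
`Q(a, c) = a²(3 − a)² − 4ca` one has `Q(Θx) = (σ₁(σ₃ − σ₂))² = (det DΘ)²`, so on `M₃`
`(σ₁σ₂σ₃)^{s−1} = (c^{s−1}/√Q)(Θx) · |det DΘ(x)|` (`s5_jacobian`). Hence
`[M₃, (σ₁σ₂σ₃)^{s−1}] − [maxCellImage, c^{s−1}/√Q] ∈ changeOfVariablesRel` is ONE instance of
rule (2) of the Kontsevich–Zagier calculus, which is the stub. No definitions are introduced:
the map `Θ`, its derivative (the continuous linear map of the Jacobian matrix
`[[σ₂(3 − 2σ₁ − σ₂), σ₁(3 − σ₁ − 2σ₂)], [1, 0]]`) and the two cells are written out literally.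

References: M. Kontsevich, D. Zagier, *Periods* (2001), §1.2 rule (2).
-/

noncomputable section

open Set MeasureTheory MvPolynomial
open Literature.NumberTheory.Transcendental Literature.NumberTheory.Transcendental.KZ
open Literature.ModelTheory.ExponentialFields (IsSemialgebraic)

namespace Summit.KontsevichZagierPeriods.TerasomaMultiplication.MultiplicationThreeBolza

open Summit.KontsevichZagierPeriods.TerasomaMultiplication.MultiplicationThreeNegative

/-! ### The coarea shear `Θ(σ₁, σ₂) = (σ₁σ₂(3 − σ₁ − σ₂), σ₁)`: derivative, semialgebraicity -/

-- adapted from Cruxes/MultiplicationThree/Disproof.lean §10 (`Θm` and its calculus)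
/-- `DΘ(x)` (the continuous linear map of the Jacobian matrix) applied to a vector. [folklore] -/
theorem s5_ΘJ_apply (x v : Fin 2 → ℝ) :
    (LinearMap.toContinuousLinearMap (Matrix.toLin'
      (!![x 1 * (3 - 2 * x 0 - x 1), x 0 * (3 - x 0 - 2 * x 1); 1, 0] :
        Matrix (Fin 2) (Fin 2) ℝ)) : (Fin 2 → ℝ) →L[ℝ] (Fin 2 → ℝ)) v =
      ![x 1 * (3 - 2 * x 0 - x 1) * v 0 + x 0 * (3 - x 0 - 2 * x 1) * v 1, v 0] := by
  change Matrix.toLin' _ v = _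
  rw [Matrix.toLin'_apply]
  funext i
  fin_cases i <;> simp [Matrix.mulVec, dotProduct, Fin.sum_univ_two]

/-- `det DΘ(σ) = −σ₁(3 − σ₁ − 2σ₂) = −σ₁(σ₃ − σ₂)`. [folklore] -/
theorem s5_det_ΘJ (x : Fin 2 → ℝ) :
    (LinearMap.toContinuousLinearMap (Matrix.toLin'
      (!![x 1 * (3 - 2 * x 0 - x 1), x 0 * (3 - x 0 - 2 * x 1); 1, 0] :
        Matrix (Fin 2) (Fin 2) ℝ)) : (Fin 2 → ℝ) →L[ℝ] (Fin 2 → ℝ)).det =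
      -(x 0 * (3 - x 0 - 2 * x 1)) := by
  change LinearMap.det (Matrix.toLin'
    (!![x 1 * (3 - 2 * x 0 - x 1), x 0 * (3 - x 0 - 2 * x 1); 1, 0] : Matrix (Fin 2) (Fin 2) ℝ)) = _
  rw [LinearMap.det_toLin', Matrix.det_fin_two]
  simp

/-- The shear `Θ` is differentiable with derivative `DΘ`. [folklore] -/
theorem s5_hasFDerivAt_Θ (x : Fin 2 → ℝ) :
    HasFDerivAt (fun z : Fin 2 → ℝ => (![z 0 * z 1 * (3 - z 0 - z 1), z 0] : Fin 2 → ℝ))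
      (LinearMap.toContinuousLinearMap (Matrix.toLin'
        (!![x 1 * (3 - 2 * x 0 - x 1), x 0 * (3 - x 0 - 2 * x 1); 1, 0] :
          Matrix (Fin 2) (Fin 2) ℝ)) : (Fin 2 → ℝ) →L[ℝ] (Fin 2 → ℝ)) x := by
  have h0 : HasFDerivAt (fun y : Fin 2 → ℝ => y 0)
      (ContinuousLinearMap.proj (R := ℝ) (φ := fun _ : Fin 2 => ℝ) 0) x :=
    hasFDerivAt_apply 0 x
  have h1 : HasFDerivAt (fun y : Fin 2 → ℝ => y 1)
      (ContinuousLinearMap.proj (R := ℝ) (φ := fun _ : Fin 2 => ℝ) 1) x :=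
    hasFDerivAt_apply 1 x
  rw [hasFDerivAt_pi']
  refine Fin.forall_fin_two.mpr ⟨?_, ?_⟩
  · have hf : (fun y : Fin 2 → ℝ => (![y 0 * y 1 * (3 - y 0 - y 1), y 0] : Fin 2 → ℝ) 0) =
        fun y => y 0 * y 1 * (3 - y 0 - y 1) :=
      funext fun y => rfl
    rw [hf]
    refine ((h0.mul h1).mul ((h0.const_sub 3).sub h1)).congr_fderiv
      (ContinuousLinearMap.ext fun v => ?_)
    simp [s5_ΘJ_apply]
    ring
  · have hf : (fun y : Fin 2 → ℝ => (![y 0 * y 1 * (3 - y 0 - y 1), y 0] : Fin 2 → ℝ) 1) =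
        fun y => y 0 := funext fun y => rfl
    rw [hf]
    refine h0.congr_fderiv (ContinuousLinearMap.ext fun v => ?_)
    simp [s5_ΘJ_apply]

/-- The shear `Θ` is a `ℚ`-semialgebraic map on any `ℚ`-semialgebraic set (it is the polynomial
map `(X₀X₁(3 − X₀ − X₁), X₀)`). [folklore] -/
theorem s5_isSemialgebraicMapOn_Θ {S : Set (Fin 2 → ℝ)} (hS : IsSemialgebraic ℚ S) :
    IsSemialgebraicMapOn ℚ S
      (fun z : Fin 2 → ℝ => (![z 0 * z 1 * (3 - z 0 - z 1), z 0] : Fin 2 → ℝ)) := by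
  convert isSemialgebraicMapOn_aeval hS
    (![X 0 * X 1 * (3 - X 0 - X 1), X 0] : Fin 2 → MvPolynomial (Fin 2) ℚ) using 2 with z
  funext i
  fin_cases i
  · simp
  · simp

/-! ### Injectivity and image of `Θ` on the max cell -/

/-- The shear `Θ` is injective on the max cell (which lies in the sheet `σ₂ < σ₃`). [folklore] -/
theorem s5_injOn_Θ :
    InjOn (fun z : Fin 2 → ℝ => (![z 0 * z 1 * (3 - z 0 - z 1), z 0] : Fin 2 → ℝ))
      {x : Fin 2 → ℝ | 0 < x 0 ∧ 0 < x 1 ∧ x 0 < 3 - x 0 - x 1 ∧ x 1 < 3 - x 0 - x 1} := by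
  rintro x ⟨hx0, hx1, hx2, hx3⟩ y ⟨hy0, hy1, hy2, hy3⟩ hxy
  have h1 : x 0 = y 0 := by simpa using congrFun hxy 1
  have h0 : y 0 * x 1 * (3 - y 0 - x 1) = y 0 * y 1 * (3 - y 0 - y 1) := by
    simpa [h1] using congrFun hxy 0
  -- `y0 · (x1 − y1)(3 − y0 − x1 − y1) = 0`
  have hfac : y 0 * ((x 1 - y 1) * (3 - y 0 - x 1 - y 1)) = 0 := by linear_combination h0
  have hpos : 0 < 3 - y 0 - x 1 - y 1 := by rw [h1] at hx3; linarith
  rcases mul_eq_zero.mp hfac with h | h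
  · linarith
  · rcases mul_eq_zero.mp h with h | h
    · funext i; fin_cases i
      · exact h1
      · simpa [sub_eq_zero] using h
    · linarith

/-- The shear `Θ` maps the max cell ONTO
`maxCellImage = {(c, a) | 0 < c, 0 < a < 3/2, 4c < a(3 − a)², (a ≤ 1 ∨ c < a²(3 − 2a))}`
(coordinates `(y 0, y 1) = (c, a)`): into, since `a(3 − a)² − 4c = a(σ₃ − σ₂)² > 0` and, for `a > 1`,
`a²(3 − 2a) − c = a(3 − 2a − σ₂)(a − σ₂) > 0`; onto, the preimage of `(c, a)` in the max cell being
`(a, ((3 − a) − √((3 − a)² − 4c/a))/2)`. [folklore] -/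
theorem s5_image_Θ :
    (fun z : Fin 2 → ℝ => (![z 0 * z 1 * (3 - z 0 - z 1), z 0] : Fin 2 → ℝ)) ''
        {x : Fin 2 → ℝ | 0 < x 0 ∧ 0 < x 1 ∧ x 0 < 3 - x 0 - x 1 ∧ x 1 < 3 - x 0 - x 1} =
      {y : Fin 2 → ℝ | 0 < y 0 ∧ 0 < y 1 ∧ 2 * y 1 < 3 ∧ 4 * y 0 < y 1 * (3 - y 1) ^ 2 ∧
        (y 1 ≤ 1 ∨ y 0 < y 1 ^ 2 * (3 - 2 * y 1))} := by
  refine subset_antisymm ?_ fun y hy => ?_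
  · rintro _ ⟨x, ⟨h0, h1, h2, h3⟩, rfl⟩
    simp only [mem_setOf_eq, Matrix.cons_val_zero, Matrix.cons_val_one]
    refine ⟨mul_pos (mul_pos h0 h1) (by linarith), h0, by linarith, ?_, ?_⟩
    · have : 0 < (3 - x 0 - 2 * x 1) ^ 2 := by
        have : 3 - x 0 - 2 * x 1 ≠ 0 := by linarith
        positivity
      nlinarith [mul_pos h0 this]
    · by_cases ha : x 0 ≤ 1
      · exact Or.inl ha
      · refine Or.inr ?_
        -- `a²(3 − 2a) − aσ₂σ₃ = a (3 − 2a − σ₂)(a − σ₂)` with both factors positive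
        have hA : 0 < 3 - 2 * x 0 - x 1 := by linarith
        have hB : 0 < x 0 - x 1 := by have := not_le.mp ha; linarith
        nlinarith [mul_pos h0 (mul_pos hA hB)]
  · obtain ⟨h0, h1, h2, h3, h4⟩ := hy
    have h4' : 0 < 4 * y 0 / y 1 := by positivity
    -- the discriminant of `σ₂(3 − a − σ₂) = c/a` is positive
    have hd : 0 < (3 - y 1) ^ 2 - 4 * y 0 / y 1 := by
      have : 4 * y 0 / y 1 < (3 - y 1) ^ 2 := by rw [div_lt_iff₀ h1]; linarith
      linarith
    set D := Real.sqrt ((3 - y 1) ^ 2 - 4 * y 0 / y 1) with hD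
    have hDpos : 0 < D := Real.sqrt_pos.mpr hd
    have hDsq : D ^ 2 = (3 - y 1) ^ 2 - 4 * y 0 / y 1 := Real.sq_sqrt hd.le
    have hDlt : D < 3 - y 1 := by nlinarith [hDsq, hDpos]
    -- the key inequality `3a − 3 < D`, i.e. `σ₁ < σ₃` for the preimage
    have hkey : 3 * y 1 - 3 < D := by
      rcases h4 with ha | hc
      · linarith
      · have hq : 4 * y 0 / y 1 < 4 * (y 1 * (3 - 2 * y 1)) := by
          rw [div_lt_iff₀ h1]; nlinarith [hc]
        have hD2 : (3 * y 1 - 3) ^ 2 < D ^ 2 := by rw [hDsq]; nlinarith [hq]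
        by_contra hle
        have hle' : D ≤ 3 * y 1 - 3 := not_lt.mp hle
        nlinarith [mul_nonneg (sub_nonneg.2 hle') (by linarith : (0:ℝ) ≤ 3 * y 1 - 3 + D)]
    refine ⟨![y 1, ((3 - y 1) - D) / 2], ⟨h1, ?_, ?_, ?_⟩, ?_⟩
    · change 0 < ((3 - y 1) - D) / 2
      linarith
    · change y 1 < 3 - y 1 - ((3 - y 1) - D) / 2
      linarith
    · change ((3 - y 1) - D) / 2 < 3 - y 1 - ((3 - y 1) - D) / 2
      linarith
    · funext i
      fin_cases i
      · change y 1 * (((3 - y 1) - D) / 2) * (3 - y 1 - ((3 - y 1) - D) / 2) = y 0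
        have : y 1 * (((3 - y 1) - D) / 2) * (3 - y 1 - ((3 - y 1) - D) / 2) =
            y 1 * ((3 - y 1) ^ 2 - D ^ 2) / 4 := by ring
        rw [this, hDsq]
        field_simp
        ring
      · rfl

/-! ### The rule-(2) integrand relation -/

/-- On the max cell, `g(σ) = f(Θσ) · |det DΘ(σ)|` for `g = (σ₁σ₂σ₃)^{s−1}` and
`f(c, a) = c^{s−1}/√Q(a, c)`, `Q(a, c) = a²(3 − a)² − 4ca`, since
`Q(Θσ) = (σ₁(3 − σ₁ − 2σ₂))² = (det DΘ(σ))²` with `σ₁(3 − σ₁ − 2σ₂) > 0`. [folklore] -/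
theorem s5_jacobian (s : ℚ) {x : Fin 2 → ℝ} (h0 : 0 < x 0) (hd : 0 < 3 - x 0 - 2 * x 1) :
    (fun z : Fin 2 → ℝ => (z 0 * z 1 * (3 - z 0 - z 1)) ^ ((s:ℝ) - 1)) x =
      (fun y : Fin 2 → ℝ =>
          (y 0) ^ ((s:ℝ) - 1) / Real.sqrt ((y 1) ^ 2 * (3 - y 1) ^ 2 - 4 * y 0 * y 1))
          (![x 0 * x 1 * (3 - x 0 - x 1), x 0] : Fin 2 → ℝ) *
        |(LinearMap.toContinuousLinearMap (Matrix.toLin'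
            (!![x 1 * (3 - 2 * x 0 - x 1), x 0 * (3 - x 0 - 2 * x 1); 1, 0] :
              Matrix (Fin 2) (Fin 2) ℝ)) : (Fin 2 → ℝ) →L[ℝ] (Fin 2 → ℝ)).det| := by
  rw [s5_det_ΘJ, abs_neg]
  simp only [Matrix.cons_val_zero, Matrix.cons_val_one]
  have hq : x 0 ^ 2 * (3 - x 0) ^ 2 - 4 * (x 0 * x 1 * (3 - x 0 - x 1)) * x 0 =
      (x 0 * (3 - x 0 - 2 * x 1)) ^ 2 := by ring
  have hdpos : 0 < x 0 * (3 - x 0 - 2 * x 1) := mul_pos h0 hd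
  rw [hq, Real.sqrt_sq hdpos.le, abs_of_pos hdpos, div_mul_cancel₀ _ hdpos.ne']

/-- Stub S5 (the simplex-side coarea shear on the max cell): `Θ(σ₁,σ₂) = (σ₁σ₂σ₃, σ₁)`,
`σ₃ = 3−σ₁−σ₂`, is injective on `M₃ = {σ₃ > σ₁, σ₃ > σ₂}` (inside the sheet `σ₂ < σ₃`) with image
`maxCellImage` and `|det DΘ| = σ₁(σ₃−σ₂) = √Q(σ₁, σ₁σ₂σ₃)`, so ONE rule-(2) move gives
`[M₃, (σ₁σ₂σ₃)^{s−1}] ~ [maxCellImage, u^{s−1}/√Q(a,u)]` (coordinates `x 0 = u = σ₁σ₂σ₃`,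
`x 1 = a = σ₁` on the right). The hypothesis `0 < s` is not used. [folklore] -/
theorem stub_maxCellToMaxCellImage :
    ∀ s : ℚ, 0 < s → ∀ (r ρ : Literature.NumberTheory.Transcendental.KZ.IntegralRep 2), r.domain = {x | 0 < x 0 ∧ 0 < x 1 ∧ x 0 < 3 - x 0 - x 1 ∧ x 1 < 3 - x 0 - x 1} → Set.EqOn r.integrand (fun x => (x 0 * x 1 * (3 - x 0 - x 1)) ^ ((s:ℝ) - 1)) r.domain → ρ.domain = {x | 0 < x 0 ∧ 0 < x 1 ∧ 2 * x 1 < 3 ∧ 4 * x 0 < x 1 * (3 - x 1) ^ 2 ∧ (x 1 ≤ 1 ∨ x 0 < x 1 ^ 2 * (3 - 2 * x 1))} → Set.EqOn ρ.integrand (fun x => (x 0) ^ ((s:ℝ) - 1) / Real.sqrt ((x 1) ^ 2 * (3 - x 1) ^ 2 - 4 * x 0 * x 1)) ρ.domain → Literature.NumberTheory.Transcendental.KZ.Equivalent r ρ := by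
  intro s _ r ρ hr hri hρ hρi
  refine changeOfVariablesRel_subset_relations ⟨2, r, ρ,
    fun z : Fin 2 → ℝ => (![z 0 * z 1 * (3 - z 0 - z 1), z 0] : Fin 2 → ℝ),
    fun x : Fin 2 → ℝ => (LinearMap.toContinuousLinearMap (Matrix.toLin'
      (!![x 1 * (3 - 2 * x 0 - x 1), x 0 * (3 - x 0 - 2 * x 1); 1, 0] :
        Matrix (Fin 2) (Fin 2) ℝ)) : (Fin 2 → ℝ) →L[ℝ] (Fin 2 → ℝ)),
    s5_isSemialgebraicMapOn_Θ r.isSemialgebraic_domain,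
    fun x _ => (s5_hasFDerivAt_Θ x).hasFDerivWithinAt, ?_, ?_, fun x hx => ?_, rfl⟩
  · rw [hr]; exact s5_injOn_Θ
  · rw [hρ, hr]; exact s5_image_Θ.symm
  · have hx' := hx
    rw [hr] at hx'
    obtain ⟨h0, h1, h2, h3⟩ := hx'
    have hmem : (![x 0 * x 1 * (3 - x 0 - x 1), x 0] : Fin 2 → ℝ) ∈ ρ.domain := by
      rw [hρ, ← s5_image_Θ]
      exact mem_image_of_mem _ (show x ∈ {x : Fin 2 → ℝ | _} from ⟨h0, h1, h2, h3⟩)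
    rw [hri hx, hρi hmem]
    exact s5_jacobian s h0 (by linarith)

end Summit.KontsevichZagierPeriods.TerasomaMultiplication.MultiplicationThreeBolza

end
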